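import Literature.AlgebraicGeometry.Motives.HodgeStructureLefschetzGroupTraceTransfer
import Literature.AlgebraicGeometry.Motives.HodgeStructureCentralizerPrimitiveCentralIdempotents
import Literature.AlgebraicGeometry.Motives.HodgeStructureEndActionCharpolyFactorFields
import Literature.Algebra.Lie.KillingBaseChange
import HarnessLib

/-!
# «`(Vᵢ, φᵢ) = (V(A), φ) ⊗_{F ⊗ k} Fᵢ`» WITHOUT SPLITTING `F`: THE COMPONENTS `φ_𝔪 = φ_{Q,K} mod 𝔪` OF MILNE'S TRANSFERRED PAIRING
# ON THE BLOCKS `V_𝔪 = ι_K(e_𝔪)(K ⊗ V)`, FOR EVERY FIELD `K ⊇ ℚ` — ORTHOGONALITY OF THE BLOCKS, `φ = φ₁ ⊕ ⋯ ⊕ φ_t`, EACH `φ_𝔪`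
# NON-DEGENERATE, AND «`S(A) = S₁ × ⋯ × S_t`»: `γ` PRESERVES `φ` IFF IT PRESERVES EVERY `φ_𝔪` ON `V_𝔪` (Milne 1999 §2 pp. 646–648)

[topic AlgebraicGeometry/Motives]

Layer `Literature/AlgebraicGeometry/Motives`, lane `lit-hodgefound` (Track 2 foundations library; prover seat
`lit-hodgefound-p02`, generation 58, self-proposed row g58-#6 — successor-menu item (i) of the seat's gen 57 «non-split reading
of Milne's transferred pairing»). Sequel, BY NAME, of p34's g20-#1 `Motives/HodgeStructureLefschetzGroupTraceTransfer` (the pairing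
`φ_{Q,K} = Q.hermitianTransferBaseChange K A : (K ⊗ V) × (K ⊗ V) → K ⊗_ℚ F` with `Tr ∘ φ_{Q,K} = Q_K`, its left `K ⊗ F`-linearity,
`σ_K`-sesquilinearity and the reading `S(H)(K) = Aut_{K ⊗ F}(K ⊗ V, φ_{Q,K})`) and g20-#3 `…TraceTransferBlocks` (the SPLIT case:
coordinates `ev_σ`, `K ⊇` all embeddings of `F`); here the factor fields `F_𝔪 = (K ⊗_ℚ F)/𝔪` of an ARBITRARY field `K ⊇ ℚ`
replace the coordinates `ev_σ : K ⊗ F → K`, and the primitive idempotents `e_𝔪` (g56-#7/#13) replace `splitIdempotent`.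
THEOREMS ONLY: no definition, no named fact (net debt `0`), no instance, no notation.

Milne (p. 647 L1–L4): «let `φ : V × V → F ⊗_ℚ k` be the skew-symmetric `F ⊗_ℚ k`-bilinear form such that `Tr_{F ⊗_ℚ k/k} φ = e_D`.
Because `φ ∘ (α × 1) = φ ∘ (1 × α)` for `α ∈ F`, `φ` decomposes into `φ = φ₁ ⊕ ⋯ ⊕ φ_t`, where `φᵢ : Vᵢ × Vᵢ → Fᵢ` is
skew-symmetric and `Fᵢ`-bilinear.»; (p. 648 L42–L52): «there is a decomposition `(V(A), φ) = (V₁, φ₁) ⊕ ⋯ ⊕ (V_t, φ_t)`,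
`(Vᵢ, φᵢ) = (V(A), φ) ⊗_{F ⊗_ℚ k} Fᵢ`. Here `φᵢ` is a nondegenerate skew-symmetric form on the `Fᵢ`-vector space `Vᵢ`. […]
Moreover, `S(A) = S₁ × ⋯ × S_t`, `Sᵢ = Res_{Fᵢ/k} Sp(φᵢ)`.» On the tree's carrier (`Q : Polarization H`, `A : EndAction H F`,
ANY field `K ⊇ ℚ`, `ι_K = baseChangeAction K A.ι`, `φ = Q.hermitianTransferBaseChange K A`, `𝔪 ∈ MaxSpec(K ⊗_ℚ F)`, `ū = u mod 𝔪`,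
`e_𝔪` primitive idempotents, blocks `V_𝔪 = range ι_K(e_𝔪)`; «type I» = the Rosati involution is trivial on `F`:
`Q(ι(a)v, w) = Q(v, ι(a)w)`) we PROVE:
(i) `φ(ι_K(e_𝔪)x, y) mod 𝔪 = φ(x, y) mod 𝔪` and `φ(ι_K(e_𝔫)x, y) mod 𝔪 = 0` for `𝔫 ≠ 𝔪`; type I: `φ(x, ι_K(z)y) = z φ(x, y)`,
**`φ(ι_K(e)x, ι_K(e')y) = e e' φ(x, y)`**, so **distinct blocks are orthogonal for `φ` AND for `Q_K = Tr ∘ φ`** («`V = V₁ ⊕ ⋯ ⊕ V_t`»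
is an orthogonal decomposition), and **`φ_𝔪(x, y) = φ_𝔪(ι_K(e_𝔪)x, ι_K(e_𝔪)y)`**: the component `φ_𝔪` only sees the block `V_𝔪`;
(ii) **`φ(x, y) = φ(x', y')` iff `φ_𝔪(x, y) = φ_𝔪(x', y')` for every `𝔪`** (`K ⊗ F ↪ ∏_𝔪 F_𝔪`) — «`φ = φ₁ ⊕ ⋯ ⊕ φ_t`»;
(iii) **`φ_{Q,K}` is non-degenerate, and (type I) each `φ_𝔪` restricted to `V_𝔪` is non-degenerate** («`φᵢ` is a nondegenerate …
form on the `Fᵢ`-vector space `Vᵢ`»);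
(iv) **«`S(A) = S₁ × ⋯ × S_t`» FOR EVERY FIELD `K`**: a map `γ` commuting with `ι_K(K ⊗ F)` preserves `φ` iff it preserves every
`φ_𝔪` on `V_𝔪 × V_𝔪`; with `E_φ = ι(F)`: `γ ∈ S(H)(K)` iff `γ` commutes with `ι_K` and preserves each `φ_𝔪|V_𝔪`;
(v) type I: `φ(y, x) = (-1)ⁿ φ(x, y)` on `K`-points (skew-symmetric in odd weight).

## The source, verbatim

J. S. Milne, *Lefschetz classes on abelian varieties*, Duke Math. J. **96** (1999) 639–675 [Milne1999LefschetzClasses] (held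
`paper:doi-10-1215-s0012-7094-99-09620-5`; Duke page = folio + 638): §2 p. 646 (p0008) L43–L48 («`F ⊗_ℚ k = F₁ × ⋯ × F_t` … `1 =
e₁ + ⋯ + e_t` … `V(A) = V₁ ⊕ ⋯ ⊕ V_t`, `Vᵢ = eᵢV = V ⊗_{F ⊗_ℚ k} Fᵢ`»), p. 647 (p0009) L1–L4 and p. 648 (p0010) L42–L52 (quoted above).

## What is PROVED (namespace `Literature.AlgebraicGeometry.Motives.HodgeStructure`)

* §1 `Polarization.mk_hermitianTransferBaseChange_baseChangeAction_left_of_notMem` / `…_of_mem` (components of `φ(ι_K(u)x, y)`),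
  `Polarization.hermitianTransferBaseChange_apply_right_of_forall_form_ι` (type I: `φ(x, ι_K(z)y) = z φ(x, y)`),
  `Polarization.hermitianTransferBaseChange_swap_of_forall_form_ι` (type I: `φ(y, x) = (-1)ⁿ φ(x, y)`),
  **`Polarization.hermitianTransferBaseChange_baseChangeAction_baseChangeAction`** (`φ(ι_K(e)x, ι_K(e')y) = (e e') φ(x, y)`),
  **`Polarization.hermitianTransferBaseChange_eq_zero_of_mul_eq_zero`**, **`Polarization.baseChange_form_eq_zero_of_mul_eq_zero`**
  (orthogonality of distinct blocks for `φ` and for `Q_K`), **`Polarization.mk_hermitianTransferBaseChange_eq_mk_blocks`**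
  (`φ_𝔪(x, y) = φ_𝔪(ι_K(e_𝔪)x, ι_K(e_𝔪)y)`).
* §2 `eq_of_forall_mk_maximalSpectrum_eq` (generic: `K ⊗ F ↪ ∏_𝔪 F_𝔪`), **`Polarization.hermitianTransferBaseChange_eq_iff_forall_mk_eq`**.
* §3 **`Polarization.hermitianTransferBaseChange_nondegenerate`**, **`Polarization.eq_zero_of_forall_mk_hermitianTransferBaseChange_eq_zero`**
  (`φ_𝔪|V_𝔪` non-degenerate, type I).
* §4 **`Polarization.forall_hermitianTransferBaseChange_eq_iff_forall_mk_blocks`** (preserving `φ` ⟺ preserving every `φ_𝔪|V_𝔪`, for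
  `γ` commuting with `ι_K`), **`Polarization.mem_lefschetzGroupBaseChange_iff_forall_mk_blocks`** (`E_φ = ι(F)`: «`S(A) = S₁ × ⋯ × S_t`»
  on `K`-points, any field `K ⊇ ℚ`).

NOT here: an `F_𝔪`-vector-space structure on `V_𝔪` as a Lean instance (the `F_𝔪`-bilinearity is stated through `ι_K` and
`Ideal.Quotient.mk`); the groups `Sp(φ_𝔪)` as algebraic groups over `F_𝔪` and the Weil restriction; types II–IV.

Nearest tree results, BY NAME: g20-#1 `Polarization.hermitianTransferBaseChange_apply_left` / `_apply_right` / `_swap`,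
`trace_hermitianTransferBaseChange`, `mem_lefschetzGroupBaseChange_iff_of_endAlg_eq_range`, `traceTransfer_nondegenerate`; g20-#3
`Polarization.forall_hermitianTransferBaseChange_eq_iff_forall_blocks` (SPLIT case, `ev_σ`); g56-#7
`HodgeStructure.completeOrthogonalIdempotents_primitiveIdempotents`, `primitiveIdempotent_mul_eq_zero_iff`; g57-#1
`mk_eq_one_of_isIdempotentElem_of_notMem`; `Literature.Algebra.Lie.KillingBaseChange.nondegenerate_baseChange` (`Q_K` non-degenerate).

## References

* [Milne1999LefschetzClasses] J. S. Milne, *Lefschetz classes on abelian varieties*, Duke Math. J. 96 (1999) 639–675, §2 p. 646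
  L43–L48, p. 647 L1–L4, p. 648 L42–L52.
-/

noncomputable section

open scoped TensorProduct

namespace Literature.AlgebraicGeometry.Motives

/-! ## §0 `K ⊗_ℚ F ↪ ∏_𝔪 F_𝔪`: an element is determined by its residues (reduced Artinian rings) -/

/-- **`z = z'` iff `z ≡ z' mod 𝔪` for every maximal ideal `𝔪`** in a reduced commutative Artin ring (`Z ≅ ∏_𝔪 Z/𝔪`, Chinese
remainder theorem). [cite: AtiyahMacdonald1969, Ch. 8 Thm 8.7] -/
theorem eq_of_forall_mk_maximalSpectrum_eq {Z : Type*} [CommRing Z] [IsArtinianRing Z] [IsReduced Z] {z z' : Z}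
    (h : ∀ I : MaximalSpectrum Z, Ideal.Quotient.mk I.asIdeal z = Ideal.Quotient.mk I.asIdeal z') : z = z' :=
  (IsArtinianRing.equivPi Z).injective (funext fun I => h I)

namespace HodgeStructure

universe u uK

variable {V : Type u} [AddCommGroup V] [Module ℚ V] {n : ℤ} {H : HodgeStructure V n}
variable {F : Type*} [Field F] [NumberField F]
variable (K : Type uK) [Field K] [Algebra ℚ K] (A : EndAction H F) (Q : Polarization H)

/-! ## §1 Components of `φ_{Q,K}` and the blocks `V_𝔪 = ι_K(e_𝔪)(K ⊗ V)` -/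

/-- **`φ(ι_K(u)x, y) ≡ φ(x, y) mod 𝔪` for an idempotent `u ∉ 𝔪`** (`ū = 1` in `F_𝔪`; e.g. `u = e_𝔪`).
[cite: Milne1999LefschetzClasses, §2 p. 647 L1–L4] -/
theorem Polarization.mk_hermitianTransferBaseChange_baseChangeAction_left_of_notMem (I : MaximalSpectrum (K ⊗[ℚ] F))
    {u : K ⊗[ℚ] F} (hu : IsIdempotentElem u) (huI : u ∉ I.asIdeal) (x y : K ⊗[ℚ] V) :
    Ideal.Quotient.mk I.asIdeal (Q.hermitianTransferBaseChange K A (baseChangeAction K A.ι u x) y) =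
      Ideal.Quotient.mk I.asIdeal (Q.hermitianTransferBaseChange K A x y) := by
  rw [Q.hermitianTransferBaseChange_apply_left K A, map_mul, mk_eq_one_of_isIdempotentElem_of_notMem (K ⊗[ℚ] F) I hu huI,
    one_mul]

/-- **`φ(ι_K(u)x, y) ≡ 0 mod 𝔪` for `u ∈ 𝔪`** (e.g. `u = e_𝔫`, `𝔫 ≠ 𝔪`: the block `V_𝔫` is invisible to `φ_𝔪`).
[cite: Milne1999LefschetzClasses, §2 p. 647 L1–L4] -/
theorem Polarization.mk_hermitianTransferBaseChange_baseChangeAction_left_of_mem (I : MaximalSpectrum (K ⊗[ℚ] F))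
    {u : K ⊗[ℚ] F} (huI : u ∈ I.asIdeal) (x y : K ⊗[ℚ] V) :
    Ideal.Quotient.mk I.asIdeal (Q.hermitianTransferBaseChange K A (baseChangeAction K A.ι u x) y) = 0 := by
  rw [Q.hermitianTransferBaseChange_apply_left K A, map_mul, Ideal.Quotient.eq_zero_iff_mem.2 huI, zero_mul]

omit [Algebra ℚ K] in
/-- `(1 ⊗ 1)_K`-twist is trivial: `congr refl refl = id` on `K ⊗_ℚ F`. [folklore] -/
private theorem congr_refl_refl_apply₅₈₆ [Algebra ℚ K] (z : K ⊗[ℚ] F) :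
    Algebra.TensorProduct.congr (AlgEquiv.refl : K ≃ₐ[K] K) (AlgEquiv.refl : F ≃ₐ[ℚ] F) z = z := by
  induction z using TensorProduct.induction_on with
  | zero => simp
  | tmul c a => rw [Algebra.TensorProduct.congr_apply, Algebra.TensorProduct.map_tmul]; rfl
  | add x y hx hy => rw [map_add, hx, hy]

/-- **TYPE I (`†` trivial on `F`): `φ` IS `K ⊗ F`-BILINEAR — `φ(x, ι_K(z)y) = z φ(x, y)`** («`φᵢ` … `Fᵢ`-bilinear»), on `K`-points,
for every field `K ⊇ ℚ`. [cite: Milne1999LefschetzClasses, §2 p. 647 L1–L4 and p. 648 L37–L45] -/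
theorem Polarization.hermitianTransferBaseChange_apply_right_of_forall_form_ι
    (hsym : ∀ a v w, Q.form (A.ι a v) w = Q.form v (A.ι a w)) (z : K ⊗[ℚ] F) (x y : K ⊗[ℚ] V) :
    Q.hermitianTransferBaseChange K A x (baseChangeAction K A.ι z y) = z * Q.hermitianTransferBaseChange K A x y := by
  rw [Q.hermitianTransferBaseChange_apply_right K A AlgEquiv.refl hsym (fun _ => rfl) z x y, congr_refl_refl_apply₅₈₆]

/-- **TYPE I: `φ(y, x) = (-1)ⁿ φ(x, y)` on `K`-points** (skew-symmetric for odd weight `n`: «`φᵢ` is … skew-symmetric»).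
[cite: Milne1999LefschetzClasses, §2 p. 647 L1–L4 and p. 648 L42–L48] -/
theorem Polarization.hermitianTransferBaseChange_swap_of_forall_form_ι
    (hsym : ∀ a v w, Q.form (A.ι a v) w = Q.form v (A.ι a w)) (x y : K ⊗[ℚ] V) :
    Q.hermitianTransferBaseChange K A y x = (((n.negOnePow : ℤˣ) : ℤ) : K) • Q.hermitianTransferBaseChange K A x y := by
  rw [Q.hermitianTransferBaseChange_swap K A AlgEquiv.refl hsym x y, congr_refl_refl_apply₅₈₆]

/-- **TYPE I: `φ(ι_K(u)x, ι_K(u')y) = (u u') φ(x, y)`.** [cite: Milne1999LefschetzClasses, §2 p. 647 L1–L4] -/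
theorem Polarization.hermitianTransferBaseChange_baseChangeAction_baseChangeAction
    (hsym : ∀ a v w, Q.form (A.ι a v) w = Q.form v (A.ι a w)) (u u' : K ⊗[ℚ] F) (x y : K ⊗[ℚ] V) :
    Q.hermitianTransferBaseChange K A (baseChangeAction K A.ι u x) (baseChangeAction K A.ι u' y) =
      (u * u') * Q.hermitianTransferBaseChange K A x y := by
  rw [Q.hermitianTransferBaseChange_apply_left K A, Q.hermitianTransferBaseChange_apply_right_of_forall_form_ι K A hsym, mul_assoc]

/-- **DISTINCT BLOCKS ARE `φ`-ORTHOGONAL (type I)**: `φ(ι_K(u)x, ι_K(u')y) = 0` whenever `u u' = 0` — e.g. `u = e_𝔪`, `u' = e_𝔫`,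
`𝔪 ≠ 𝔫`: «`(V(A), φ) = (V₁, φ₁) ⊕ ⋯ ⊕ (V_t, φ_t)`» is an orthogonal sum. [cite: Milne1999LefschetzClasses, §2 p. 648 L42–L45] -/
theorem Polarization.hermitianTransferBaseChange_eq_zero_of_mul_eq_zero
    (hsym : ∀ a v w, Q.form (A.ι a v) w = Q.form v (A.ι a w)) {u u' : K ⊗[ℚ] F} (huu' : u * u' = 0) (x y : K ⊗[ℚ] V) :
    Q.hermitianTransferBaseChange K A (baseChangeAction K A.ι u x) (baseChangeAction K A.ι u' y) = 0 := by
  rw [Q.hermitianTransferBaseChange_baseChangeAction_baseChangeAction K A hsym, huu', zero_mul]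

/-- **DISTINCT BLOCKS ARE `Q_K`-ORTHOGONAL (type I)**: `Q_K(ι_K(u)x, ι_K(u')y) = 0` whenever `u u' = 0` (`Q_K = Tr ∘ φ`): «`V(A) =
V₁ ⊕ ⋯ ⊕ V_t`» is an orthogonal decomposition for `e_D` itself. [cite: Milne1999LefschetzClasses, §2 p. 646 L41–L47 and p. 648 L42–L45] -/
theorem Polarization.baseChange_form_eq_zero_of_mul_eq_zero
    (hsym : ∀ a v w, Q.form (A.ι a v) w = Q.form v (A.ι a w)) {u u' : K ⊗[ℚ] F} (huu' : u * u' = 0) (x y : K ⊗[ℚ] V) :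
    Q.form.baseChange K (baseChangeAction K A.ι u x) (baseChangeAction K A.ι u' y) = 0 := by
  rw [← Q.trace_hermitianTransferBaseChange K A, Q.hermitianTransferBaseChange_eq_zero_of_mul_eq_zero K A hsym huu', map_zero]

/-- **`φ_𝔪` ONLY SEES THE BLOCK `V_𝔪` (type I): `φ(x, y) ≡ φ(ι_K(e_𝔪)x, ι_K(e_𝔪)y) mod 𝔪`** for an idempotent `e_𝔪 ∉ 𝔪` —
«`(Vᵢ, φᵢ) = (V(A), φ) ⊗_{F ⊗_ℚ k} Fᵢ`». [cite: Milne1999LefschetzClasses, §2 p. 648 L42–L45] -/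
theorem Polarization.mk_hermitianTransferBaseChange_eq_mk_blocks
    (hsym : ∀ a v w, Q.form (A.ι a v) w = Q.form v (A.ι a w)) (I : MaximalSpectrum (K ⊗[ℚ] F))
    {e : K ⊗[ℚ] F} (he : IsIdempotentElem e) (heI : e ∉ I.asIdeal) (x y : K ⊗[ℚ] V) :
    Ideal.Quotient.mk I.asIdeal (Q.hermitianTransferBaseChange K A x y) =
      Ideal.Quotient.mk I.asIdeal
        (Q.hermitianTransferBaseChange K A (baseChangeAction K A.ι e x) (baseChangeAction K A.ι e y)) := by
  rw [Q.hermitianTransferBaseChange_baseChangeAction_baseChangeAction K A hsym, he.eq, map_mul,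
    mk_eq_one_of_isIdempotentElem_of_notMem (K ⊗[ℚ] F) I he heI, one_mul]

/-! ## §2 «`φ = φ₁ ⊕ ⋯ ⊕ φ_t`»: `φ` is determined by its components `φ_𝔪` -/

/-- **`φ(x, y) = φ(x', y')` iff `φ_𝔪(x, y) = φ_𝔪(x', y')` for every `𝔪 ∈ MaxSpec(K ⊗_ℚ F)`** (`K ⊗_ℚ F = ∏_𝔪 F_𝔪` is reduced):
«`φ = φ₁ ⊕ ⋯ ⊕ φ_t`». [cite: Milne1999LefschetzClasses, §2 p. 647 L1–L4] -/
theorem Polarization.hermitianTransferBaseChange_eq_iff_forall_mk_eq (x y x' y' : K ⊗[ℚ] V) :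
    Q.hermitianTransferBaseChange K A x y = Q.hermitianTransferBaseChange K A x' y' ↔
      ∀ I : MaximalSpectrum (K ⊗[ℚ] F), Ideal.Quotient.mk I.asIdeal (Q.hermitianTransferBaseChange K A x y) =
        Ideal.Quotient.mk I.asIdeal (Q.hermitianTransferBaseChange K A x' y') := by
  refine ⟨fun h I => by rw [h], fun h => ?_⟩
  haveI : IsArtinianRing (K ⊗[ℚ] F) := IsArtinianRing.of_finite K _
  haveI := isReduced_baseChange_numberField K F
  exact eq_of_forall_mk_maximalSpectrum_eq h

/-! ## §3 Non-degeneracy of `φ_{Q,K}` and of each `φ_𝔪` on `V_𝔪` -/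

/-- **`φ_{Q,K}` IS NON-DEGENERATE** (`Q_K` is, and the transfer along a non-degenerate trace form preserves non-degeneracy).
[cite: Milne1999LefschetzClasses, §2 p. 646 L38–L42 and p. 648 L45] -/
theorem Polarization.hermitianTransferBaseChange_nondegenerate [Module.Finite ℚ V] :
    (Q.hermitianTransferBaseChange K A).Nondegenerate :=
  traceTransfer_nondegenerate _ _ _ (Literature.Algebra.Lie.KillingBaseChange.nondegenerate_baseChange Q.nondegenerate)

/-- **EACH `φ_𝔪` IS NON-DEGENERATE ON ITS BLOCK `V_𝔪` (type I)**: if `x ∈ V_𝔪 = ι_K(e_𝔪)(K ⊗ V)` pairs to `0 mod 𝔪` with every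
`y ∈ V_𝔪`, then `x = 0` — «`φᵢ` is a nondegenerate skew-symmetric form on the `Fᵢ`-vector space `Vᵢ`». (For `𝔫 ≠ 𝔪`, `φ_𝔫(x, ·) = 0`
automatically since `e_𝔪 ∈ 𝔫`; and `φ_𝔪(x, y) = φ_𝔪(x, ι_K(e_𝔪)y)`; so `φ(x, ·) = 0`.) [cite: Milne1999LefschetzClasses, §2 p. 648 L42–L45] -/
theorem Polarization.eq_zero_of_forall_mk_hermitianTransferBaseChange_eq_zero [Module.Finite ℚ V]
    (hsym : ∀ a v w, Q.form (A.ι a v) w = Q.form v (A.ι a w)) (I : MaximalSpectrum (K ⊗[ℚ] F)) {e : K ⊗[ℚ] F}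
    (he : IsIdempotentElem e) (heI : e ∉ I.asIdeal) (heJ : ∀ J : MaximalSpectrum (K ⊗[ℚ] F), J ≠ I → e ∈ J.asIdeal)
    {x : K ⊗[ℚ] V} (hx : x ∈ LinearMap.range (baseChangeAction K A.ι e))
    (h : ∀ y ∈ LinearMap.range (baseChangeAction K A.ι e),
      Ideal.Quotient.mk I.asIdeal (Q.hermitianTransferBaseChange K A x y) = 0) :
    x = 0 := by
  haveI : IsArtinianRing (K ⊗[ℚ] F) := IsArtinianRing.of_finite K _
  haveI := isReduced_baseChange_numberField K F
  refine (Q.hermitianTransferBaseChange_nondegenerate K A).1 x fun y => ?_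
  obtain ⟨x₀, rfl⟩ := hx
  refine eq_of_forall_mk_maximalSpectrum_eq fun J => ?_
  rw [map_zero]
  by_cases hJ : J = I
  · subst hJ
    -- `φ_𝔪(x, y) = φ_𝔪(x, ι_K(e)y) = 0`
    have h1 := h (baseChangeAction K A.ι e y) (LinearMap.mem_range_self _ y)
    rwa [Q.hermitianTransferBaseChange_apply_right_of_forall_form_ι K A hsym, map_mul,
      mk_eq_one_of_isIdempotentElem_of_notMem (K ⊗[ℚ] F) J he heI, one_mul] at h1
  · exact Q.mk_hermitianTransferBaseChange_baseChangeAction_left_of_mem K A J (heJ J hJ) x₀ y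

/-! ## §4 «`S(A) = S₁ × ⋯ × S_t`» for every field `K ⊇ ℚ`: `γ` preserves `φ` iff it preserves every `φ_𝔪` on `V_𝔪` -/

/-- **A MAP COMMUTING WITH `ι_K(K ⊗ F)` PRESERVES `φ` IFF IT PRESERVES EVERY COMPONENT `φ_𝔪` ON THE BLOCK `V_𝔪 × V_𝔪`** (type I, any
primitive family `e_𝔪`): «`S(A) = S₁ × ⋯ × S_t`, `Sᵢ = Res_{Fᵢ/k} Sp(φᵢ)`» — read for an ARBITRARY field `K ⊇ ℚ` on the factor fields
`F_𝔪 = (K ⊗_ℚ F)/𝔪` (the split case `F_𝔪 = K` is g20-#3 `forall_hermitianTransferBaseChange_eq_iff_forall_blocks`).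
[cite: Milne1999LefschetzClasses, §2 p. 648 L42–L52] -/
theorem Polarization.forall_hermitianTransferBaseChange_eq_iff_forall_mk_blocks
    (hsym : ∀ a v w, Q.form (A.ι a v) w = Q.form v (A.ι a w)) (e : MaximalSpectrum (K ⊗[ℚ] F) → K ⊗[ℚ] F)
    (he : ∀ I, IsIdempotentElem (e I) ∧ e I ∉ I.asIdeal ∧ ∀ J : MaximalSpectrum (K ⊗[ℚ] F), J ≠ I → e I ∈ J.asIdeal)
    {γ : K ⊗[ℚ] V → K ⊗[ℚ] V} (hγ : ∀ (z : K ⊗[ℚ] F) x, γ (baseChangeAction K A.ι z x) = baseChangeAction K A.ι z (γ x)) :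
    (∀ x y, Q.hermitianTransferBaseChange K A (γ x) (γ y) = Q.hermitianTransferBaseChange K A x y) ↔
      ∀ I : MaximalSpectrum (K ⊗[ℚ] F), ∀ x ∈ LinearMap.range (baseChangeAction K A.ι (e I)),
        ∀ y ∈ LinearMap.range (baseChangeAction K A.ι (e I)),
          Ideal.Quotient.mk I.asIdeal (Q.hermitianTransferBaseChange K A (γ x) (γ y)) =
            Ideal.Quotient.mk I.asIdeal (Q.hermitianTransferBaseChange K A x y) := by
  refine ⟨fun h I x _ y _ => by rw [h], fun h x y => ?_⟩
  rw [Q.hermitianTransferBaseChange_eq_iff_forall_mk_eq K A]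
  intro I
  rw [Q.mk_hermitianTransferBaseChange_eq_mk_blocks K A hsym I (he I).1 (he I).2.1 (γ x) (γ y), ← hγ, ← hγ,
    h I _ (LinearMap.mem_range_self _ x) _ (LinearMap.mem_range_self _ y),
    ← Q.mk_hermitianTransferBaseChange_eq_mk_blocks K A hsym I (he I).1 (he I).2.1 x y]

variable {K} in
/-- **«`S(A) = S₁ × ⋯ × S_t`, `Sᵢ = Res_{Fᵢ/k} Sp(φᵢ)`» ON `K`-POINTS, FOR EVERY FIELD `K ⊇ ℚ`, WITHOUT SPLITTING `F`** (`E_φ = ι(F)`,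
type I): `γ ∈ S(H)(K)` iff `γ` commutes with `ι_K(K ⊗ F)` and preserves every component `φ_𝔪` on its block `V_𝔪`.
[cite: Milne1999LefschetzClasses, §2 p. 648 L42–L52] -/
theorem Polarization.mem_lefschetzGroupBaseChange_iff_forall_mk_blocks (hE : H.endAlg = A.ι.range)
    (hsym : ∀ a v w, Q.form (A.ι a v) w = Q.form v (A.ι a w)) (e : MaximalSpectrum (K ⊗[ℚ] F) → K ⊗[ℚ] F)
    (he : ∀ I, IsIdempotentElem (e I) ∧ e I ∉ I.asIdeal ∧ ∀ J : MaximalSpectrum (K ⊗[ℚ] F), J ≠ I → e I ∈ J.asIdeal)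
    (γ : (K ⊗[ℚ] V) ≃ₗ[K] (K ⊗[ℚ] V)) :
    γ ∈ Q.lefschetzGroupBaseChange K ↔
      (∀ (z : K ⊗[ℚ] F) x, γ (baseChangeAction K A.ι z x) = baseChangeAction K A.ι z (γ x)) ∧
        ∀ I : MaximalSpectrum (K ⊗[ℚ] F), ∀ x ∈ LinearMap.range (baseChangeAction K A.ι (e I)),
          ∀ y ∈ LinearMap.range (baseChangeAction K A.ι (e I)),
            Ideal.Quotient.mk I.asIdeal (Q.hermitianTransferBaseChange K A (γ x) (γ y)) =
              Ideal.Quotient.mk I.asIdeal (Q.hermitianTransferBaseChange K A x y) := by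
  rw [Q.mem_lefschetzGroupBaseChange_iff_of_endAlg_eq_range A hE γ]
  exact and_congr_right fun hγ => Q.forall_hermitianTransferBaseChange_eq_iff_forall_mk_blocks K A hsym e he hγ

end HodgeStructure

end Literature.AlgebraicGeometry.Motives
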